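import Summits.HodgeConjecture.CorCM.PointwiseConjugationCMFieldsHodge
import HarnessLib

/-!
# Pointwise partial conjugations, the field form: `y₀(K_b) ⊄ x(K_a) · y₀(K_b⁺)` — a compositum criterion deciding
# the common constituents of two CM slots

COR-CM (cell `pub-hodgecm2`, binder seat `b16` gen 48, count-neutral claim PTCONJ, file F3 — Galois theory in `ℂ`;
theorems only, no definition, no named fact, no `sorry`).  NEW as stated, hence under `Summits/`.  HONEST FRAMING: a
field-theoretic criterion and its consequences for NAMED classes of CM abelian varieties; `HC_CM` is neither used nor
asserted.

`PointwiseConjugationCMFieldsHodge` (this seat) shows that two CM slots `Hom(K_a, ℂ)`, `Hom(K_b, ℂ)` have no common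
constituent iff (PC): every `x : K_a → ℂ` admits `σ ∈ Aut(ℂ)` with `σ ∘ x = x̄` and `σ ∘ y₀ = y₀` (one base point
`y₀ : K_b → ℂ`).  Here (PC) is translated into the language of COMPOSITA.  Write `M = x(K_a)`, `N = y₀(K_b)`,
`N⁺ = y₀(K_b⁺)` (`K_b⁺` the maximal real subfield; `[N : N⁺] = 2`).

> **Theorem** (`exists_conj_smul_iff_not_le`).  `∃ σ ∈ Aut(ℂ), σ ∘ x = x̄ ∧ σ ∘ y₀ = y₀`  **iff**  `N ⊄ M · N⁺`,
> i.e. iff the compositum `x(K_a) · y₀(K_b⁺)` does not contain `y₀(K_b)` (equivalently `[M N : M N⁺] = 2`; summed over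
> the conjugates `x`: the `ℚ`-algebras `K_a ⊗ K_b` and `K_a ⊗ K_b⁺` have the same number of simple factors).

PROOF.  ⟹ (`not_le_of_conj_smul`): `τ = conj ∘ σ` fixes `M` (where `σ` is conjugation) and `N⁺` (real, fixed by `σ`),
hence `M · N⁺`; if `N ≤ M · N⁺` then `τ` fixes `N`, i.e. `conj = σ = id` on `N` — but `y₀` is not a real embedding.
⟸ (`exists_conj_smul_of_not_le`): take a primitive element `α` of `K_b`; `n = y₀(α) ∉ P = M · N⁺` (else `N = ℚ(n) ≤ P`),
while `s = n + n̄ = y₀(α + ᾱ)` and `p = n n̄` lie in `N⁺ ≤ P`; so the minimal polynomial of `n` over `P` is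
`X² − sX + p`, whose other root is `n̄`; the `P`-embedding `P(n) → ℂ`, `n ↦ n̄` extends to `τ ∈ Aut(ℂ)` (transcendence
bases, the tree's `ZarhinLie.exists_ringEquiv_complex_comp_eq`); `τ` fixes `P ⊇ M` and `τ ∘ y₀ = conj ∘ y₀` (they agree
at the primitive `α`); `σ = conj ∘ τ` is conjugation on `M` and the identity on `N`.  The engine
`exists_ringEquiv_fix_apply_eq_conj` is stated for any finite `P ≤ ℂ` and any `n ∉ P` with `n + n̄, n n̄ ∈ P`.

CONSEQUENCES (§3, by `PointwiseConjugationCMFieldsHodge`): under `∀ x, N ⊄ x(K_a) · N⁺` the slots have no common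
constituent (`pairwise_of_forall_not_le`), the pair `(Φ_a, Φ_b)` is nondegenerate iff both members are
(`isNondegenerateFamily_iff_pair_of_forall_not_le`), `Hg(A_a × A_b) = Hg(A_a) × Hg(A_b)`, and for nondegenerate
realisations the Hodge conjecture and `B• = D•` hold on every `A_a^m × A_b^n` (`hodgeConjectureFor_prod_pair_of_forall_not_le`);
for NONDEGENERATE types the compositum condition is EQUIVALENT to the absence of common constituents
(`pairwise_iff_forall_not_le`).  EXAMPLES of the dichotomy: a shared imaginary quadratic `k = ℚ(√−d)` (`√−d ∈ M` and
`N = N⁺(√−d) ≤ M N⁺`); the reflex pair of non-Galois quartic CM fields (`k₄ · (k₄')⁺` is the dihedral closure `⊇ k₄'`):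
common constituent; linearly disjoint fields, or `[M N : ℚ] > [K_a : ℚ][K_b : ℚ]/2` for every compositum: none.

## References

* [Lang2002] S. Lang, *Algebra*, GTM 211, V §2 Thm. 2.8 (extension of embeddings), VI §1 Thm. 1.12 (composita).
* [Shimura1998] G. Shimura, *Abelian Varieties with Complex Multiplication and Modular Functions*, §18.2 Lemma (complex
  conjugation on a CM field commutes with all embeddings; `K = K⁺(α)`).
* [Gordon1999HodgeAVSurvey] B. B. Gordon, *A survey of the Hodge conjecture for abelian varieties*, §3 Theorem (Imai,
  Murty) with proof; 7.5–7.7; 10.10.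
* [Serre1977] J.-P. Serre, *Linear Representations of Finite Groups*, GTM 42, §7.3–7.4.
-/

noncomputable section

open CategoryTheory CategoryTheory.Limits NumberField NumberField.ComplexEmbedding IntermediateField Polynomial
open scoped BigOperators IntermediateField

namespace Summit.HodgeConjecture.CorCM

open Literature.NumberTheory.ComplexMultiplication
open Literature.AlgebraicGeometry.Motives (AbelianVariety CMType)
open Literature.AlgebraicGeometry.HodgeTheory
open Literature.AlgebraicGeometry.ComplexMultiplication (IsCMTypeRealisation)
open Literature.AlgebraicGeometry.VanGeemen1994 (hodgeClassSpan)
open Literature.AlgebraicGeometry.Pohlmann1968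
open Literature.Barriers.HodgeConjecture (divisorClassesSpan)

/-! ## §1 The engine: an automorphism of `ℂ` fixing `P` and conjugating a quadratic `n ∉ P` with `n + n̄, n n̄ ∈ P` -/

section Engine

/-- A finite extension of `ℚ` inside `ℂ` is countable. [folklore] -/
private theorem countable_of_finiteDimensional₄₈ (C : IntermediateField ℚ ℂ) [FiniteDimensional ℚ C] :
    Countable C :=
  Countable.of_equiv _ (Module.finBasis ℚ C).equivFun.toEquiv.symm

/-- **The quadratic over `P`.**  For `n ∈ ℂ` with `n ∉ P` but `n + n̄ ∈ P`, `n · n̄ ∈ P` (`P ≤ ℂ` any subfield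
containing `ℚ`): `n` is integral over `P`, its minimal polynomial over `P` has degree `2` (it is `X² − (n + n̄)X + n n̄`),
and `n̄` is a root of it. [cite: Lang2002, V §1 Prop. 1.4] -/
theorem natDegree_minpoly_eq_two_of_add_conj_mem (P : IntermediateField ℚ ℂ) {n : ℂ}
    (hs : n + starRingEnd ℂ n ∈ P) (hp : n * starRingEnd ℂ n ∈ P) (hn : n ∉ P) :
    ∃ _ : IsIntegral P n, (minpoly P n).natDegree = 2 ∧ aeval (starRingEnd ℂ n) (minpoly P n) = 0 := by
  classical
  set s : P := ⟨_, hs⟩ with hs_def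
  set p : P := ⟨_, hp⟩ with hp_def
  -- the quadratic `f = X² − s X + p ∈ P[X]`
  set f : Polynomial P := X ^ 2 - C s * X + C p with hf_def
  have hf2 : f = X ^ 2 + C (-s) * X + C p := by rw [hf_def, map_neg]; ring
  have hfdeg : f.natDegree = 2 := by
    rw [hf2]
    compute_degree!
  have hfmonic : f.Monic := by
    rw [Monic, leadingCoeff, hfdeg, hf2]
    simp
  have haeval : ∀ w : ℂ, aeval w f = w ^ 2 - (n + starRingEnd ℂ n) * w + n * starRingEnd ℂ n := by
    intro w
    rw [hf_def, map_add, map_sub, map_mul, map_pow, aeval_X, aeval_C, aeval_C]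
    rfl
  have hfn : aeval n f = 0 := by rw [haeval]; ring
  have hfnbar : aeval (starRingEnd ℂ n) f = 0 := by rw [haeval]; ring
  have hint : IsIntegral P n := ⟨f, hfmonic, by rwa [← aeval_def]⟩
  -- `f` is the minimal polynomial (degree `2`, `n ∉ P`)
  have h2 : 2 ≤ (minpoly P n).natDegree := by
    rw [minpoly.two_le_natDegree_iff hint]
    rintro ⟨a, ha⟩
    exact hn (by rw [← ha]; exact a.2)
  have hmin : f = minpoly P n :=
    Polynomial.eq_of_monic_of_dvd_of_natDegree_le (minpoly.monic hint) hfmonic (minpoly.dvd P n hfn)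
      (by rw [hfdeg]; exact h2)
  exact ⟨hint, by rw [← hmin, hfdeg], by rw [← hmin]; exact hfnbar⟩

/-- **Engine.**  Let `P ≤ ℂ` be a finite extension of `ℚ` and `n ∈ ℂ` with `n ∉ P` but `n + n̄ ∈ P`, `n · n̄ ∈ P`.  Then
some `τ ∈ Aut(ℂ)` fixes `P` pointwise and maps `n ↦ n̄`: the minimal polynomial of `n` over `P` is `X² − (n + n̄)X + n n̄`
with second root `n̄`, the `P`-embedding `P(n) → ℂ`, `n ↦ n̄`, exists, and it extends to `ℂ` (transcendence bases).
[cite: Lang2002, V §2 Thm. 2.8] -/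
theorem exists_ringEquiv_fix_apply_eq_conj (P : IntermediateField ℚ ℂ) [FiniteDimensional ℚ P] {n : ℂ}
    (hs : n + starRingEnd ℂ n ∈ P) (hp : n * starRingEnd ℂ n ∈ P) (hn : n ∉ P) :
    ∃ τ : ℂ ≃+* ℂ, (∀ z : ℂ, z ∈ P → τ z = z) ∧ τ n = starRingEnd ℂ n := by
  classical
  obtain ⟨hint, hdeg, hbar⟩ := natDegree_minpoly_eq_two_of_add_conj_mem P hs hp hn
  have hroot : starRingEnd ℂ n ∈ (minpoly P n).aroots ℂ := by
    rw [mem_aroots]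
    exact ⟨minpoly.ne_zero hint, hbar⟩
  -- the `P`-embedding `P⟮n⟯ → ℂ`, `n ↦ n̄`
  set τ₀ : P⟮n⟯ →ₐ[P] ℂ := (algHomAdjoinIntegralEquiv P hint).symm ⟨_, hroot⟩ with hτ₀_def
  have hτ₀n : τ₀ (AdjoinSimple.gen P n) = starRingEnd ℂ n :=
    algHomAdjoinIntegralEquiv_symm_apply_gen P hint ⟨_, hroot⟩
  -- extend to `ℂ` (countable source)
  haveI : FiniteDimensional P P⟮n⟯ := adjoin.finiteDimensional hint
  haveI : Countable P := countable_of_finiteDimensional₄₈ P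
  haveI : Countable P⟮n⟯ := Countable.of_equiv _ (Module.finBasis P P⟮n⟯).equivFun.toEquiv.symm
  obtain ⟨τ, hτ⟩ := Literature.AlgebraicGeometry.Motives.ZarhinLie.exists_ringEquiv_complex_comp_eq
    (algebraMap P⟮n⟯ ℂ) (τ₀ : P⟮n⟯ →+* ℂ)
  refine ⟨τ, fun z hz => ?_, ?_⟩
  · have h1 := hτ (algebraMap P P⟮n⟯ ⟨z, hz⟩)
    rw [← IsScalarTower.algebraMap_apply] at h1
    -- `h1 : τ (algebraMap P ℂ ⟨z, hz⟩) = τ₀ (algebraMap P P⟮n⟯ ⟨z, hz⟩)`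
    change τ z = τ₀ (algebraMap P P⟮n⟯ ⟨z, hz⟩) at h1
    rw [h1, AlgHom.commutes]
    rfl
  · have h1 := hτ (AdjoinSimple.gen P n)
    rw [AdjoinSimple.algebraMap_gen] at h1
    exact h1.trans hτ₀n

end Engine

/-! ## §2 The criterion: `∃ σ, σ ∘ x = x̄ ∧ σ ∘ y₀ = y₀` iff `y₀(K_b) ⊄ x(K_a) · y₀(K_b⁺)` -/

section Criterion

variable {I : Type} {K : I → Type} [∀ i, Field (K i)] [∀ i, NumberField (K i)] [∀ i, IsCMField (K i)]

omit [∀ i, IsCMField (K i)] in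
/-- The image of an embedding of a number field is finite over `ℚ`. [folklore] -/
private theorem finiteDimensional_fieldRange₄₈ {i : I} (s : K i →+* ℂ) :
    FiniteDimensional ℚ s.toRatAlgHom.fieldRange :=
  LinearEquiv.finiteDimensional (AlgEquiv.ofInjectiveField s.toRatAlgHom).toLinearEquiv

omit [∀ i, IsCMField (K i)] in
/-- The image `y₀(K⁺)` of the maximal real subfield is finite over `ℚ`. [folklore] -/
private theorem finiteDimensional_realRange₄₈ {i : I} (s : K i →+* ℂ) :
    FiniteDimensional ℚ (s.comp (maximalRealSubfield (K i)).subtype).toRatAlgHom.fieldRange :=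
  LinearEquiv.finiteDimensional
    (AlgEquiv.ofInjectiveField (s.comp (maximalRealSubfield (K i)).subtype).toRatAlgHom).toLinearEquiv

omit [∀ i, IsCMField (K i)] in
/-- The image `y₀(K⁺)` consists of real numbers. [folklore] -/
private theorem conj_eq_of_mem_realRange {i : I} (s : K i →+* ℂ) {z : ℂ}
    (hz : z ∈ (s.comp (maximalRealSubfield (K i)).subtype).toRatAlgHom.fieldRange) : starRingEnd ℂ z = z := by
  obtain ⟨⟨r, hr⟩, rfl⟩ := AlgHom.mem_fieldRange.1 hz
  exact (mem_maximalRealSubfield_iff r).1 hr s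

/-- `y₀(r + r̄)` and `y₀(r r̄)` lie in `y₀(K⁺)`: `y₀ r + conj (y₀ r)`, `y₀ r · conj (y₀ r) ∈ y₀(K⁺)`.
[cite: Shimura1998, §18.2 Lemma] -/
private theorem add_conj_mem_realRange {i : I} (s : K i →+* ℂ) (r : K i) :
    s r + starRingEnd ℂ (s r) ∈ (s.comp (maximalRealSubfield (K i)).subtype).toRatAlgHom.fieldRange ∧
    s r * starRingEnd ℂ (s r) ∈ (s.comp (maximalRealSubfield (K i)).subtype).toRatAlgHom.fieldRange := by
  have hc : ∀ w : K i, starRingEnd ℂ (s w) = s (IsCMField.complexConj (K i) w) := fun w =>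
    (IsCMField.complexEmbedding_complexConj (K i) s w).symm
  have h1 : r + IsCMField.complexConj (K i) r ∈ maximalRealSubfield (K i) := by
    rw [mem_maximalRealSubfield_iff]
    intro φ
    rw [map_add, IsCMField.complexEmbedding_complexConj (K i) φ r, star_add, RCLike.star_def, starRingEnd_self_apply,
      add_comm]
  have h2 : r * IsCMField.complexConj (K i) r ∈ maximalRealSubfield (K i) := by
    rw [mem_maximalRealSubfield_iff]
    intro φ
    rw [map_mul, IsCMField.complexEmbedding_complexConj (K i) φ r, star_mul, RCLike.star_def, starRingEnd_self_apply]
  refine ⟨AlgHom.mem_fieldRange.2 ⟨⟨_, h1⟩, ?_⟩, AlgHom.mem_fieldRange.2 ⟨⟨_, h2⟩, ?_⟩⟩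
  · change s (r + IsCMField.complexConj (K i) r) = _
    rw [map_add, hc]
  · change s (r * IsCMField.complexConj (K i) r) = _
    rw [map_mul, hc]

omit [∀ i, IsCMField (K i)] in
/-- For a PRIMITIVE element `α` of `K_b` (`ℚ(α) = K_b`): `y₀(K_b) ≤ P ⟺ y₀(α) ∈ P`. [cite: Lang2002, V §4 Thm. 4.6] -/
private theorem fieldRange_le_iff_of_primitive {b : I} (y₀ : K b →+* ℂ) {α : K b} (hα : ℚ⟮α⟯ = ⊤)
    (P : IntermediateField ℚ ℂ) : y₀.toRatAlgHom.fieldRange ≤ P ↔ y₀ α ∈ P := by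
  rw [AlgHom.fieldRange_eq_map, ← hα, adjoin_map, Set.image_singleton, adjoin_simple_le_iff]
  rfl

/-- **⟸: `y₀(K_b) ⊄ x(K_a) · y₀(K_b⁺)` gives `σ ∈ Aut(ℂ)` with `σ ∘ x = x̄`, `σ ∘ y₀ = y₀`.**  (A primitive element `α`
of `K_b` has `n = y₀ α ∉ P = x(K_a) · y₀(K_b⁺)` while `n + n̄, n n̄ ∈ y₀(K_b⁺) ≤ P`; the engine gives `τ` fixing `P`
with `τ n = n̄`, so `τ ∘ y₀ = conj ∘ y₀`; take `σ = conj ∘ τ`.) [cite: Lang2002, V §2 Thm. 2.8] [cite: Shimura1998, §18.2 Lemma] -/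
theorem exists_conj_smul_of_not_le {a b : I} (x : K a →+* ℂ) (y₀ : K b →+* ℂ)
    (h : ¬ y₀.toRatAlgHom.fieldRange ≤
      x.toRatAlgHom.fieldRange ⊔ (y₀.comp (maximalRealSubfield (K b)).subtype).toRatAlgHom.fieldRange) :
    ∃ σ : ℂ ≃+* ℂ, σ • x = (starRingAut : ℂ ≃+* ℂ) • x ∧ σ • y₀ = y₀ := by
  classical
  set M : IntermediateField ℚ ℂ := x.toRatAlgHom.fieldRange with hM_def
  set R : IntermediateField ℚ ℂ := (y₀.comp (maximalRealSubfield (K b)).subtype).toRatAlgHom.fieldRange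
    with hR_def
  haveI : FiniteDimensional ℚ M := finiteDimensional_fieldRange₄₈ x
  haveI : FiniteDimensional ℚ R := finiteDimensional_realRange₄₈ y₀
  haveI : FiniteDimensional ℚ (M ⊔ R : IntermediateField ℚ ℂ) := IntermediateField.finiteDimensional_sup M R
  -- a primitive element of `K_b`; its image is outside `P = M ⊔ R`
  obtain ⟨α, hα⟩ := Field.exists_primitive_element ℚ (K b)
  have hn : y₀ α ∉ M ⊔ R := fun hmem => h ((fieldRange_le_iff_of_primitive y₀ hα (M ⊔ R)).2 hmem)
  obtain ⟨hs, hp⟩ := add_conj_mem_realRange y₀ α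
  obtain ⟨τ, hτP, hτn⟩ := exists_ringEquiv_fix_apply_eq_conj (M ⊔ R) (le_sup_right (a := M) hs)
    (le_sup_right (a := M) hp) hn
  -- `τ ∘ y₀ = conj ∘ y₀`: two `ℚ`-algebra maps agreeing at the primitive `α`
  have hτy : ∀ w : K b, τ (y₀ w) = starRingEnd ℂ (y₀ w) := by
    have hA : ∀ w : K b, ((minpoly ℚ w).map (algebraMap ℚ ℂ)).Splits := fun w => IsAlgClosed.splits _
    let φ : K b →ₐ[ℚ] ℂ := (τ.toRingHom.comp y₀).toRatAlgHom
    let ψ : K b →ₐ[ℚ] ℂ := ((starRingEnd ℂ).comp y₀).toRatAlgHom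
    have hφψ : φ = ψ := (Field.primitive_element_iff_algHom_eq_of_eval ℚ ℂ hA α φ).1 hα ψ hτn
    intro w
    exact congrArg (fun χ : K b →ₐ[ℚ] ℂ => χ w) hφψ
  refine ⟨τ.trans (starRingAut : ℂ ≃+* ℂ), RingHom.ext fun w => ?_, RingHom.ext fun w => ?_⟩
  · have hw : x w ∈ M ⊔ R := le_sup_left (b := R) (AlgHom.mem_fieldRange.2 ⟨w, rfl⟩)
    rw [ringEquiv_smul_apply, ringEquiv_smul_apply, RingEquiv.coe_trans, Function.comp_apply, hτP (x w) hw]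
  · rw [ringEquiv_smul_apply, RingEquiv.coe_trans, Function.comp_apply, hτy, starRingAut_apply,
      ← starRingEnd_apply, starRingEnd_self_apply]

/-- **⟹: `σ ∘ x = x̄`, `σ ∘ y₀ = y₀` forces `y₀(K_b) ⊄ x(K_a) · y₀(K_b⁺)`.**  (`τ = conj ∘ σ` fixes `x(K_a)` and the real
field `y₀(K_b⁺)`, hence their compositum; it does not fix `y₀(K_b)`, on which it is complex conjugation.)
[cite: Lang2002, VI §1 Thm. 1.12] [cite: Shimura1998, §18.2 Lemma] -/
theorem not_le_of_conj_smul {a b : I} {x : K a →+* ℂ} {y₀ : K b →+* ℂ} {σ : ℂ ≃+* ℂ}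
    (hσx : σ • x = (starRingAut : ℂ ≃+* ℂ) • x) (hσy : σ • y₀ = y₀) :
    ¬ y₀.toRatAlgHom.fieldRange ≤
      x.toRatAlgHom.fieldRange ⊔ (y₀.comp (maximalRealSubfield (K b)).subtype).toRatAlgHom.fieldRange := by
  intro hle
  -- `τ = conj ∘ σ` as a `ℚ`-algebra automorphism of `ℂ`, and its fixed field
  set τ : ℂ ≃+* ℂ := σ.trans (starRingAut : ℂ ≃+* ℂ) with hτ_def
  have hτ : ∀ z, τ z = starRingEnd ℂ (σ z) := fun z => rfl
  let τA : ℂ ≃ₐ[ℚ] ℂ := AlgEquiv.ofRingEquiv (f := τ) fun q => by rw [eq_ratCast]; exact map_ratCast τ q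
  have hτA : ∀ z, τA z = τ z := fun _ => rfl
  set F : IntermediateField ℚ ℂ := IntermediateField.fixedField (Subgroup.zpowers τA) with hF_def
  have hF : ∀ z : ℂ, z ∈ F ↔ τ z = z := by
    intro z
    rw [hF_def, IntermediateField.mem_fixedField_iff, Subgroup.forall_mem_zpowers, ← hτA]
    exact (MulAction.mem_fixedBy_zpowers_iff_mem_fixedBy (α := ℂ) (g := τA) (a := z))
  -- `x(K_a) ≤ F` and `y₀(K_b⁺) ≤ F`
  have hM : x.toRatAlgHom.fieldRange ≤ F := by
    intro z hz
    obtain ⟨w, rfl⟩ := AlgHom.mem_fieldRange.1 hz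
    rw [hF, hτ]
    change starRingEnd ℂ (σ (x w)) = x w
    rw [← ringEquiv_smul_apply σ x w, hσx, ringEquiv_smul_apply, starRingAut_apply, ← starRingEnd_apply,
      starRingEnd_self_apply]
  have hR : (y₀.comp (maximalRealSubfield (K b)).subtype).toRatAlgHom.fieldRange ≤ F := by
    intro z hz
    have hreal := conj_eq_of_mem_realRange y₀ hz
    obtain ⟨⟨r, hr⟩, rfl⟩ := AlgHom.mem_fieldRange.1 hz
    rw [hF, hτ]
    change starRingEnd ℂ (σ (y₀ r)) = y₀ r
    rw [← ringEquiv_smul_apply σ y₀ r, hσy]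
    exact hreal
  -- hence `y₀(K_b) ≤ F`: `y₀` would be a real embedding
  have hN : ∀ w : K b, starRingEnd ℂ (y₀ w) = y₀ w := by
    intro w
    have hw : y₀ w ∈ F := (hle.trans (sup_le hM hR)) (AlgHom.mem_fieldRange.2 ⟨w, rfl⟩)
    rw [hF, hτ] at hw
    change starRingEnd ℂ (σ (y₀ w)) = y₀ w at hw
    rwa [← ringEquiv_smul_apply σ y₀ w, hσy] at hw
  have hreal : ComplexEmbedding.IsReal y₀ := by
    rw [ComplexEmbedding.isReal_iff]
    exact RingHom.ext fun w => by rw [ComplexEmbedding.conjugate_coe_eq]; exact hN w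
  exact IsTotallyComplex.complexEmbedding_not_isReal y₀ hreal

/-- **The compositum criterion.**  `∃ σ ∈ Aut(ℂ), σ ∘ x = x̄ ∧ σ ∘ y₀ = y₀` **iff** `y₀(K_b) ⊄ x(K_a) · y₀(K_b⁺)`
(`[x(K_a) y₀(K_b) : x(K_a) y₀(K_b⁺)] = 2`). [cite: Lang2002, V §2 Thm. 2.8 and VI §1 Thm. 1.12] -/
theorem exists_conj_smul_iff_not_le {a b : I} (x : K a →+* ℂ) (y₀ : K b →+* ℂ) :
    (∃ σ : ℂ ≃+* ℂ, σ • x = (starRingAut : ℂ ≃+* ℂ) • x ∧ σ • y₀ = y₀) ↔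
    ¬ y₀.toRatAlgHom.fieldRange ≤
      x.toRatAlgHom.fieldRange ⊔ (y₀.comp (maximalRealSubfield (K b)).subtype).toRatAlgHom.fieldRange :=
  ⟨fun ⟨_, hσx, hσy⟩ => not_le_of_conj_smul hσx hσy, exists_conj_smul_of_not_le x y₀⟩

/-- **(PC) in compositum form**: every pair `(x, y)` admits a pointwise partial conjugation iff
`y₀(K_b) ⊄ x(K_a) · y₀(K_b⁺)` for every conjugate `x(K_a)` (one base point `y₀`).
[cite: Lang2002, V §2 Thm. 2.8 and VI §1 Thm. 1.12] -/
theorem pointwiseConj_iff_forall_not_le {a b : I} (y₀ : K b →+* ℂ) :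
    (∀ (x : K a →+* ℂ) (y : K b →+* ℂ), ∃ σ : ℂ ≃+* ℂ, σ • x = (starRingAut : ℂ ≃+* ℂ) • x ∧ σ • y = y) ↔
    ∀ x : K a →+* ℂ, ¬ y₀.toRatAlgHom.fieldRange ≤
      x.toRatAlgHom.fieldRange ⊔ (y₀.comp (maximalRealSubfield (K b)).subtype).toRatAlgHom.fieldRange :=
  ⟨fun h x => (exists_conj_smul_iff_not_le x y₀).1 (h x y₀),
    fun h => pointwiseConj_of_basePoint y₀ fun x => (exists_conj_smul_iff_not_le x y₀).2 (h x)⟩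

end Criterion

/-! ## §3 Consequences: common constituents, nondegeneracy, the Hodge conjecture on `A_a^m × A_b^n` -/

section Consequences

variable {I : Type} {K : I → Type} [∀ i, Field (K i)] [∀ i, NumberField (K i)] [∀ i, IsCMField (K i)]

/-- **`y₀(K_b) ⊄ x(K_a) · y₀(K_b⁺)` for all `x` ⟹ no common constituent** (both orders, all CM types).
[cite: Gordon1999HodgeAVSurvey, §3 Theorem (proof)] [cite: Serre1977, §7.3–7.4] -/
theorem pairwise_of_forall_not_le (Φ : ∀ i, CMType (K i)) {a b : I} (y₀ : K b →+* ℂ)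
    (h : ∀ x : K a →+* ℂ, ¬ y₀.toRatAlgHom.fieldRange ≤
      x.toRatAlgHom.fieldRange ⊔ (y₀.comp (maximalRealSubfield (K b)).subtype).toRatAlgHom.fieldRange) :
    (∀ P : Submodule ℚ ((K a →+* ℂ) → ℚ), P ≤ antiSpan (ℂ ≃+* ℂ) (Φ a).1 →
      (∀ g : ℂ ≃+* ℂ, ∀ f ∈ P, (fun x => f (g • x)) ∈ P) →
      ∀ T : ((K a →+* ℂ) → ℚ) →ₗ[ℚ] ((K b →+* ℂ) → ℚ),
        (∀ g : ℂ ≃+* ℂ, ∀ f ∈ P, T (fun x => f (g • x)) = fun y => T f (g • y)) →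
        (∀ f ∈ P, T f ∈ antiSpan (ℂ ≃+* ℂ) (Φ b).1) → (∀ f ∈ P, T f = 0 → f = 0) → P = ⊥) ∧
    (∀ P : Submodule ℚ ((K b →+* ℂ) → ℚ), P ≤ antiSpan (ℂ ≃+* ℂ) (Φ b).1 →
      (∀ g : ℂ ≃+* ℂ, ∀ f ∈ P, (fun x => f (g • x)) ∈ P) →
      ∀ T : ((K b →+* ℂ) → ℚ) →ₗ[ℚ] ((K a →+* ℂ) → ℚ),
        (∀ g : ℂ ≃+* ℂ, ∀ f ∈ P, T (fun x => f (g • x)) = fun y => T f (g • y)) →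
        (∀ f ∈ P, T f ∈ antiSpan (ℂ ≃+* ℂ) (Φ a).1) → (∀ f ∈ P, T f = 0 → f = 0) → P = ⊥) :=
  pairwise_of_pointwiseConj_basePoint Φ y₀ fun x => exists_conj_smul_of_not_le x y₀ (h x)

variable [Fintype I] [DecidableEq I]

/-- **Two slots under the compositum condition: nondegenerate iff both members are** (all CM types).
[cite: Gordon1999HodgeAVSurvey, §3 Theorem and 7.5] -/
theorem isNondegenerateFamily_iff_pair_of_forall_not_le {i₀ i₁ : I} (h01 : i₀ ≠ i₁) (hI : ∀ j, j = i₀ ∨ j = i₁)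
    (Φ : ∀ i, CMType (K i)) (y₀ : K i₁ →+* ℂ)
    (h : ∀ x : K i₀ →+* ℂ, ¬ y₀.toRatAlgHom.fieldRange ≤
      x.toRatAlgHom.fieldRange ⊔ (y₀.comp (maximalRealSubfield (K i₁)).subtype).toRatAlgHom.fieldRange) :
    CMAlgebra.IsNondegenerateFamily Φ ↔ ∀ i, IsNondegenerate (Φ i) :=
  isNondegenerateFamily_iff_pair_of_pointwiseConj h01 hI Φ y₀ fun x => exists_conj_smul_of_not_le x y₀ (h x)

/-- **Two slots under the compositum condition: `rank(Φ_{i₀}, Φ_{i₁}) + 2 = rank Φ_{i₀} + rank Φ_{i₁} + 1`**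
(`Hg(A₀ × A₁) = Hg(A₀) × Hg(A₁)`, all CM types). [cite: Gordon1999HodgeAVSurvey, §3 Theorem (1)] -/
theorem cmFamilyRank_add_card_eq_pair_of_forall_not_le {i₀ i₁ : I} (h01 : i₀ ≠ i₁) (hI : ∀ j, j = i₀ ∨ j = i₁)
    (Φ : ∀ i, CMType (K i)) (y₀ : K i₁ →+* ℂ)
    (h : ∀ x : K i₀ →+* ℂ, ¬ y₀.toRatAlgHom.fieldRange ≤
      x.toRatAlgHom.fieldRange ⊔ (y₀.comp (maximalRealSubfield (K i₁)).subtype).toRatAlgHom.fieldRange) :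
    CMAlgebra.cmFamilyRank Φ + Fintype.card I = (∑ i, cmTypeRank (Φ i)) + 1 :=
  cmFamilyRank_add_card_eq_pair_of_pointwiseConj h01 hI Φ y₀ fun x => exists_conj_smul_of_not_le x y₀ (h x)

variable {Φ : ∀ i, CMType (K i)} {A : I → AbelianVariety ℂ} {ι : ∀ i, 𝓞 (K i) →+* End (A i)}
  {θ : ∀ i, K i →+* Module.End ℂ (complexBetti (A i).X 1)}

/-- **Two CM abelian varieties of nondegenerate types whose fields satisfy the compositum condition**
(`y₀(K_{i₁}) ⊄ x(K_{i₀}) · y₀(K_{i₁}⁺)` for every `x`): the Hodge conjecture and `B• = D•` on EVERY `A₀^m × A₁^n`,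
UNCONDITIONALLY. [cite: Gordon1999HodgeAVSurvey, §3 Theorem, 7.5 and 10.10] [cite: MoonenZarhin1999LowDim, Thm. (0.2) (4)] -/
theorem hodgeConjectureFor_prod_pair_of_forall_not_le {i₀ i₁ : I} (h01 : i₀ ≠ i₁) (hI : ∀ j, j = i₀ ∨ j = i₁)
    (y₀ : K i₁ →+* ℂ)
    (h : ∀ x : K i₀ →+* ℂ, ¬ y₀.toRatAlgHom.fieldRange ≤
      x.toRatAlgHom.fieldRange ⊔ (y₀.comp (maximalRealSubfield (K i₁)).subtype).toRatAlgHom.fieldRange)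
    (hΦ : ∀ i, IsNondegenerate (Φ i)) (hA : ∀ i, IsCMTypeRealisation (Φ i) (A i) (ι i) (θ i)) {N : ℕ}
    (π : Fin N → I) :
    HodgeConjectureFor (⨁ fun j : Fin N => A (π j)).dim (⨁ fun j : Fin N => A (π j)).X ∧
      ∀ m : ℕ, hodgeClassSpan (⨁ fun j : Fin N => A (π j)).dim (⨁ fun j : Fin N => A (π j)).X m =
        divisorClassesSpan (⨁ fun j : Fin N => A (π j)).X (⨁ fun j : Fin N => A (π j)).dim m :=
  hodgeConjectureFor_prod_pair_of_pointwiseConj h01 hI y₀ (fun x => exists_conj_smul_of_not_le x y₀ (h x)) hΦ hA π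

omit [Fintype I] [DecidableEq I] in
/-- **The decision procedure for nondegenerate types**: the slots `a → b` have no common constituent **iff**
`y₀(K_b) ⊄ x(K_a) · y₀(K_b⁺)` for every conjugate `x(K_a)` — equivalently iff `K_a ⊗_ℚ K_b` and `K_a ⊗_ℚ K_b⁺` have the
same number of simple factors. [cite: Serre1977, §7.3–7.4] [cite: Gordon1999HodgeAVSurvey, §3 Theorem and 7.5] -/
theorem pairwise_iff_forall_not_le (Φ : ∀ i, CMType (K i)) {a b : I} (ha : IsNondegenerate (Φ a))
    (hb : IsNondegenerate (Φ b)) (y₀ : K b →+* ℂ) :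
    (∀ P : Submodule ℚ ((K a →+* ℂ) → ℚ), P ≤ antiSpan (ℂ ≃+* ℂ) (Φ a).1 →
      (∀ g : ℂ ≃+* ℂ, ∀ f ∈ P, (fun x => f (g • x)) ∈ P) →
      ∀ T : ((K a →+* ℂ) → ℚ) →ₗ[ℚ] ((K b →+* ℂ) → ℚ),
        (∀ g : ℂ ≃+* ℂ, ∀ f ∈ P, T (fun x => f (g • x)) = fun y => T f (g • y)) →
        (∀ f ∈ P, T f ∈ antiSpan (ℂ ≃+* ℂ) (Φ b).1) → (∀ f ∈ P, T f = 0 → f = 0) → P = ⊥) ↔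
    ∀ x : K a →+* ℂ, ¬ y₀.toRatAlgHom.fieldRange ≤
      x.toRatAlgHom.fieldRange ⊔ (y₀.comp (maximalRealSubfield (K b)).subtype).toRatAlgHom.fieldRange := by
  rw [pairwise_iff_pointwiseConj_basePoint Φ ha hb y₀]
  exact forall_congr' fun x => exists_conj_smul_iff_not_le x y₀

end Consequences

end Summit.HodgeConjecture.CorCM

end
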